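import Mathlib
import Literature.NumberTheory.Transcendental.PreBlochGroup
import Literature.NumberTheory.Transcendental.BlochWignerDilogarithm
import HarnessLib

/-!
# The Bloch group of a number field and the Borel regulator (Borel; Bloch, Suslin)

For a number field `F` the BLOCH GROUP `B(F) ⊆ P(F)` is the kernel of the (complex) Dehn
invariant `δ : P(F) → Fˣ ∧ Fˣ`, `[z] ↦ (1 - z) ∧ z` (Neumann, *Hilbert's 3rd problem and
invariants of 3-manifolds*, Geom. Topol. Monogr. 1 (1998), Prop./Def. 2.5 and §2 after Thm. 2.10:
"we can define a Bloch group `B(k)` analogously for any field `k`" [Neumann1998]), and the named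
fact of this file is Neumann's Theorem 3.2, "a reinterpretation of a theorem of Borel [Borel1977]
about `K₃(ℂ)`": *the Borel regulator map `B(k) → ℝ^{r₂}`, induced on generators of `P(k)` by
`[z] ↦ (vol[σ₁(z)], …, vol[σ_{r₂}(z)])`, maps `B(k)/(torsion)` isomorphically onto a full lattice
in `ℝ^{r₂}`* (here `vol[z] = D(z)` is the Bloch–Wigner dilogarithm and `σ₁, …, σ_{r₂}` are the
complex embeddings up to conjugation). Behind it: Borel, *Cohomologie de `SL_n` et valeurs de
fonctions zêta aux points entiers* (1977) (injectivity of the regulator on `K₃(F)/torsion`, rank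
`r₂`) [Borel1977] and Suslin, *`K₃` of a field and the Bloch group* (1991), Thm. 5.2
(`B(F)` versus `K₃^{ind}(F)`) [Suslin1991].

## What is transcribed

Only the KERNEL statement of Thm. 3.2, in the torsion-insensitive form the route
`KontsevichZagierPeriods/HyperbolicBloch` consumes, and in the vocabulary of `PreBlochGroup.lean`
(`PreBloch.Gen F = F ∖ {0,1}`, `PreBloch.proj : ℤ⟨F ∖ {0,1}⟩ → P(F)`):

* `PreBloch.wedgePairing u v` — the alternating pairing `⟨u ∧ v, δ[z]⟩ = u(1 - z) v(z) - v(1 - z) u(z)`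
  of two additive characters `u, v : Fˣ → ℚ` with the Dehn invariant `δ[z] = (1 - z) ∧ z`,
  extended additively to `ℤ⟨F ∖ {0,1}⟩`. For `ξ ∈ ℤ⟨F ∖ {0,1}⟩` the following are equivalent
  (linear algebra over `ℚ`: `(Fˣ ∧ Fˣ) ⊗ ℚ = Λ²_ℚ(Fˣ ⊗ ℚ)`, and decomposable alternating forms
  `u ∧ v` separate the points of `Λ²` of a `ℚ`-vector space): (i) `wedgePairing u v ξ = 0` for all
  `u, v`; (ii) `δ(ξ) ⊗ 1 = 0` in `(Fˣ ∧ Fˣ) ⊗ ℚ`; (iii) some positive multiple of `ξ` lies in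
  `B(F) = ker δ` (for ANY of the torsion conventions for `Fˣ ∧ Fˣ`, cf. Neumann's footnote
  "definitions of `B(k)` in the literature vary in ways that can mildly affect its torsion").
* `PreBloch.regulatorAt σ` — the component `[z] ↦ D(σ z)` of the Borel regulator at an embedding
  `σ : F → ℂ`.
* `Borel1977_blochGroup_regulator_kernel_torsion` — THE FACT: if (i) holds and every component of
  the regulator vanishes on `ξ`, then the class of `ξ` in `P(F)` is torsion. (From Thm. 3.2: by
  (iii) `N • ξ ∈ B(F)` for some `N ≥ 1`; its regulator vanishes, so it is torsion in `B(F) ⊆ P(F)`.)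
  We quantify over ALL ring embeddings `σ : F →+* ℂ` (both members of each conjugate pair and the
  real embeddings, on which `D ∘ σ = 0` anyway) — equivalent to Neumann's `σ₁, …, σ_{r₂}` since
  `D(z̄) = -D(z)`.

NOT transcribed: finite generation / rank `r₂` of `B(F)`, the full-lattice (covolume, `ζ_F(2)`)
part of Thm. 3.2, the identification with `K₃^{ind}`, and the definition of `B(F)` as a group (only
the torsion-free shadow (i) of the membership `ξ ∈ B(F)` is needed and defined).

## References

* W. D. Neumann, Geom. Topol. Monogr. 1 (1998) 383–411, arXiv:math/9712226: Prop./Def. 2.5, Thm. 3.2.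
  [Neumann1998]
* A. Borel, Ann. Sc. Norm. Super. Pisa (4) 4 (1977) 613–636. [Borel1977]
* A. A. Suslin, Proc. Steklov Inst. Math. 183 (1991) 217–239, Thm. 5.2. [Suslin1991]
-/

noncomputable section

namespace Literature.NumberTheory.Transcendental

namespace PreBloch

variable {F : Type*} [Field F]

/-- The unit `z ∈ Fˣ` underlying a generator `z ∈ F ∖ {0,1}`. [cite: Neumann1998, Prop. 2.5] -/
def Gen.unit (g : Gen F) : Fˣ := Units.mk0 g.val g.val_ne_zero

/-- The unit `1 - z ∈ Fˣ` attached to a generator `z ∈ F ∖ {0,1}`. [cite: Neumann1998, Prop. 2.5] -/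
def Gen.unitOneSub (g : Gen F) : Fˣ := Units.mk0 (1 - g.val) (sub_ne_zero.2 g.val_ne_one.symm)

/-- The value of `Gen.unit`. [cite: Neumann1998, Prop. 2.5] -/
@[simp] theorem Gen.val_unit (g : Gen F) : (g.unit : F) = g.val := rfl

/-- The value of `Gen.unitOneSub`. [cite: Neumann1998, Prop. 2.5] -/
@[simp] theorem Gen.val_unitOneSub (g : Gen F) : (g.unitOneSub : F) = 1 - g.val := rfl

/-- **The Dehn invariant paired with a decomposable alternating form.** For additive characters
`u, v : Fˣ → ℚ`, the additive map `ℤ⟨F ∖ {0,1}⟩ → ℚ`,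
`[z] ↦ ⟨u ∧ v, (1 - z) ∧ z⟩ = u(1 - z)·v(z) - v(1 - z)·u(z)`. An element `ξ` is killed by all
these pairings iff its Dehn invariant `δ(ξ) = Σ nᵢ (1 - zᵢ) ∧ zᵢ` vanishes in `(Fˣ ∧ Fˣ) ⊗ ℚ`,
i.e. iff a positive multiple of `ξ` lies in the Bloch group `B(F) = ker δ`.
[cite: Neumann1998, Prop. 2.5] -/
def wedgePairing (u v : Additive Fˣ →+ ℚ) : FreeAbelianGroup (Gen F) →+ ℚ :=
  FreeAbelianGroup.lift fun g =>
    u (Additive.ofMul g.unitOneSub) * v (Additive.ofMul g.unit) -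
      v (Additive.ofMul g.unitOneSub) * u (Additive.ofMul g.unit)

/-- The pairing on a generator. [cite: Neumann1998, Prop. 2.5] -/
@[simp] theorem wedgePairing_of (u v : Additive Fˣ →+ ℚ) (g : Gen F) :
    wedgePairing u v (FreeAbelianGroup.of g) =
      u (Additive.ofMul g.unitOneSub) * v (Additive.ofMul g.unit) -
        v (Additive.ofMul g.unitOneSub) * u (Additive.ofMul g.unit) :=
  FreeAbelianGroup.lift_apply_of _ _

/-- The pairing is alternating in the two characters. [cite: Neumann1998, Prop. 2.5] -/
theorem wedgePairing_swap (u v : Additive Fˣ →+ ℚ) (ξ : FreeAbelianGroup (Gen F)) :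
    wedgePairing v u ξ = -wedgePairing u v ξ := by
  induction ξ using FreeAbelianGroup.induction_on with
  | zero => simp
  | of g => simp only [wedgePairing_of]; ring
  | neg g ih => rw [map_neg, map_neg, ih]
  | add x y hx hy => rw [map_add, map_add, hx, hy, neg_add]

/-- **A component of the Borel regulator**: for an embedding `σ : F → ℂ`, the additive map
`ℤ⟨F ∖ {0,1}⟩ → ℝ`, `[z] ↦ vol[σ z] = D(σ z)` (`D` the Bloch–Wigner dilogarithm).
[cite: Neumann1998, Thm. 3.2] -/
def regulatorAt (σ : F →+* ℂ) : FreeAbelianGroup (Gen F) →+ ℝ :=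
  FreeAbelianGroup.lift fun g => blochWignerDilog (σ g.val)

/-- The regulator component on a generator. [cite: Neumann1998, Thm. 3.2] -/
@[simp] theorem regulatorAt_of (σ : F →+* ℂ) (g : Gen F) :
    regulatorAt σ (FreeAbelianGroup.of g) = blochWignerDilog (σ g.val) :=
  FreeAbelianGroup.lift_apply_of _ _

end PreBloch

/-- NAMED FACT — **the Borel regulator is injective on the Bloch group of a number field modulo
torsion** (Neumann 1998, Thm. 3.2, "a reinterpretation of a theorem of Borel [1977] about `K₃(ℂ)`":
the map `B(k) → ℝ^{r₂}`, `[z] ↦ (vol[σ₁ z], …, vol[σ_{r₂} z])`, maps `B(k)/torsion` isomorphically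
onto a full lattice; with Suslin 1991, Thm. 5.2). Transcribed kernel statement: for a number field
`F` and `ξ = Σ nᵢ[zᵢ] ∈ ℤ⟨F ∖ {0,1}⟩` whose Dehn invariant vanishes rationally (every pairing
`PreBloch.wedgePairing u v` kills `ξ`, i.e. a positive multiple of `ξ` lies in `B(F)`), if
`Σ nᵢ D(σ zᵢ) = 0` for every embedding `σ : F → ℂ` then the class of `ξ` in the pre-Bloch group
`P(F)` is torsion. [cite: Neumann1998, Thm. 3.2] -/
def Borel1977_blochGroup_regulator_kernel_torsion : Prop :=
  ∀ (F : Type) [Field F] [NumberField F] (ξ : FreeAbelianGroup (PreBloch.Gen F)),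
    (∀ u v : Additive Fˣ →+ ℚ, PreBloch.wedgePairing u v ξ = 0) →
    (∀ σ : F →+* ℂ, PreBloch.regulatorAt σ ξ = 0) →
      ∃ N : ℕ, 0 < N ∧ N • PreBloch.proj ξ = 0

end Literature.NumberTheory.Transcendental

end

/-! ## Relocated from `Summits/KontsevichZagierPeriods/KontsevichZagierPeriods/Theorems/HyperbolicBlochZagierDilogarithmConjectureBorelRank.lean` (gate, accept-time relocation of cited facts) — Neumann1998 -/

namespace Literature.NumberTheory.Transcendental

open Literature.NumberTheory.Transcendental

/-- **Borel's rank theorem for the Bloch group of a number field** (with Suslin's comparison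
`B(F) ⊗ ℚ ≅ K₃^{ind}(F) ⊗ ℚ`; Neumann 1998, Thm. 3.2: "The Borel regulator `B(k) → ℝ^{r₂}` maps
`B(k)/torsion` isomorphically onto a full lattice"; Zagier 2007, Ch. I §5). Transcribed RANK statement
(the kernel statement is `Borel1977_blochGroup_regulator_kernel_torsion`): for a number field `F` with
`r₂ = nrComplexPlaces F` complex places and any `m > r₂` elements `ξ₁, …, ξ_m ∈ ℤ⟨F ∖ {0,1}⟩` whose
rational Bloch symbols vanish (every wedge pairing `PreBloch.wedgePairing u v`, `u, v : Fˣ → ℚ`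
additive, kills each `ξ_j` — i.e. a positive multiple of each `ξ_j` lies in the Bloch group `B(F)`),
there is a non-trivial `ℤ`-linear relation among their classes in the pre-Bloch group `P(F)` modulo
torsion: `dim_ℚ (B(F) ⊗ ℚ) ≤ r₂`. [cite: Neumann1998, Thm. 3.2]
[file NumberTheory/Transcendental/BlochGroupRegulator] -/
def Borel1977_blochGroup_rank_le : Prop :=
  ∀ (F : Type) [Field F] [NumberField F] (m : ℕ) (ξ : Fin m → FreeAbelianGroup (PreBloch.Gen F)),
    (∀ j, ∀ u v : Additive Fˣ →+ ℚ, PreBloch.wedgePairing u v (ξ j) = 0) →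
    NumberField.InfinitePlace.nrComplexPlaces F < m →
      ∃ a : Fin m → ℤ, a ≠ 0 ∧ ∃ n : ℕ, 0 < n ∧ n • PreBloch.proj (∑ j, a j • ξ j) = 0

end Literature.NumberTheory.Transcendental
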